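import Summits.BirchSwinnertonDyer.BirchSwinnertonDyer.Theorems.PrintCf2RubinValueTwoKatzMeasureJZeroSeamBridgeOfReadingsVbarCube
import Literature.NumberTheory.EllipticCurves.DivisionPointReadingsAtLevelVbarCube
import HarnessLib

/-!
# (hβ_i) with the Tate unit exposed, AT `F = K_v`, ALL READINGS DISCHARGED — modulus `𝔪 ≤ (π₁³)` (B10f-e (2) WITHOUT the `2^k`-hypothesis;
# tame set `S = ∅` included; proofs only)

Cell `bsd-print-cf2`, width seat `bsd-line-cf2-p1-w5` g18 (hand-over from `bsd-line-cf2c-w4` g16, LEAD ruling R-N1-S∅).  The `K_v`-instance of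
`exists_tateUnit_forall_relColemanSeries_eq_subst_subst_of_readings_of_le_span_cube` (`…SeamBridgeOfReadingsVbarCube`): `F := K_v`,
`ι_v := absClosureEmbedding K K_v`, with EVERY reading binder (the levelwise `q/w/z` readings and the four (N1) families `Y/S/W/Z`) DISCHARGED by
`DivisionPointReadings.exists_divisionPt_readings` / `exists_divisionPt_readings_at_level_of_le_span_sq` from clause (vi) of the fifth print
(II.1.5 (15), hypothesis `h6` with its conductor ideal `𝔣ψ`) for a READING MODULUS `𝔑 ≤ 𝔣ψ·𝔪·(π₁)` (`v ∤ 𝔑`) whose `α`-datum the unramified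
base `E` satisfies (`hdegE`); `[hEll]` stays a binder.  This is the statement of `bsd-line-cf2c-w4` g16's
`exists_tateUnit_forall_relColemanSeries_eq_subst_subst_of_lane` (B10f-e (2)) VERBATIM except that its hypothesis `∀ k, 2^k ∉ 𝔪` — false for
the lane modulus `𝔪_M = v̄^M` of the EMPTY tame set — is replaced by `(hprime₁ : Prime π₁) (h𝔪π₁ : 𝔪 ≤ Ideal.span {π₁ ^ 3})` (every lane
modulus with `M ≥ 3`; at the frame `π₁ := 1 − α₀`, see `…KatzMeasureJZeroFrameSevenConjugate`); conclusion TOKEN-EQUAL.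

★★★ `exists_tateUnit_forall_relColemanSeries_eq_subst_subst_of_lane_of_le_span_cube`: **`∃ (readings x_u, y_u, X_u, Y_u of ξ(u_{m+1}))
(a ∈ 𝒪_vˣ), (four reading equations) ∧ (∀ m, P(h([a]ω_{m+1})) = (X_u m, Y_u m)) ∧ ∀ i, g_{β_i} = (Q_{R,i}^ψ ∘ [1]_{P′,f}) ∘ [a]_f`** — the
division points are returned WITH their complex arguments `u_{m+1} = β_K^{m+1}Ω − Ω/π₀^{m+1}`.  Remaining hypotheses: lane `ℤ₂`-datum,
units/theta values, split-prime data (`π₁` prime, `𝔪 ≤ (π₁³)`), model lattice, `ub`, theta datum over `R`, CM datum, `h6`/`𝔣ψ`, reading modulus.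
No summit statement is proved; BSD is not proved by any of this.

## References
* [deShalit1987] E. de Shalit, *Iwasawa theory of elliptic curves with complex multiplication* (1987), I §2.2 Theorem, II §1.5 (15), II §1.10,
  II §4.4 (iv), II §4.9 (23)–(24) and Proposition (ii), II §4.14 (38).
* [SilvermanAEC2009] J. H. Silverman, *The Arithmetic of Elliptic Curves*, 2nd ed. (2009), III.2.3, VI.3.6 (b), VII.2.1–VII.2.2.
-/

-- the summit namespace `Summit.BirchSwinnertonDyer.BirchSwinnertonDyer` repeats the problem name by design (D-0017)
set_option linter.dupNamespace false
set_option autoImplicit false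

noncomputable section

open scoped Classical
open scoped NumberField
open PeriodPair Literature.NumberTheory.EllipticCurves Literature.NumberTheory.EllipticCurves.DivisionPointReadings
open Literature.NumberTheory.ComplexMultiplication.EllipticUnits
open NumberField Field IsDedekindDomain IsDedekindDomain.HeightOneSpectrum ValuativeRel PowerSeries
open Literature.NumberTheory.NumberFields
open Literature.NumberTheory.GaloisRepresentations Literature.NumberTheory.GaloisRepresentations.IsNonarchimedeanLocalField
  Literature.NumberTheory.GaloisRepresentations.LubinTate Literature.NumberTheory.EllipticCurves.FormalGroupChart _root_.WeierstrassCurve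

namespace Summit.BirchSwinnertonDyer.BirchSwinnertonDyer.Theorems.PrintCf2.KatzMeasureJZeroSeam

attribute [local instance] ltNormUniformSpace ltNormIsUniformAddGroup rk1 nF nE fintypeResidueField

variable {K : Type} [Field K] [NumberField K] {𝔪 : Ideal (𝓞 K)} {v : HeightOneSpectrum (𝓞 K)}

/-- ★★★ **(hβ_i) at `K_v` with the Tate unit exposed and all readings discharged, modulus `𝔪 ≤ (π₁³)`** (see the module docstring): the
`K_v`-instance of `exists_tateUnit_forall_relColemanSeries_eq_subst_subst_of_readings_of_le_span_cube` with the reading binders supplied by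
`exists_divisionPt_readings` (levelwise `q/w/z`) and `exists_divisionPt_readings_at_level_of_le_span_sq` (the (N1) families, `choose`n over the
level), the readings of `ξ(u_{m+1})` returned together with `a`. [cite: deShalit1987, I §2.2 Theorem, II §1.5 (15), II §1.10, II §4.4 (iv), II §4.9 (ii), II §4.14 (38)]
[cite: SilvermanAEC2009, III.2.3, VI.3.6 (b), VII.2.1–VII.2.2] -/
theorem exists_tateUnit_forall_relColemanSeries_eq_subst_subst_of_lane_of_le_span_cube [IsTotallyComplex K]
    -- the lane: a local field `(v.adicCompletion K)` with `e : 𝒪_F ≃ ℤ₂`, a uniformizer `π` with `e π = π_ℤ`, the ordinary `ℤ₂`-datum of the integer model `W`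
    (e : 𝒪[(v.adicCompletion K)] ≃+* ℤ_[2]) (hq : residueFieldCard (v.adicCompletion K) = 2)
    {π : 𝒪[(v.adicCompletion K)]} (hπ : (valuation (v.adicCompletion K)).IsUniformizer (π : (v.adicCompletion K)))
    {πZ : ℤ_[2]} (heπ : e π = πZ) (hA : IsLTRing πZ 2) {P : PowerSeries ℤ_[2]} (hP : IsLTSeries πZ 2 P) (W : WeierstrassCurve ℤ)
    (hW : W = ⟨1, -1, 0, -2, -1⟩) (hV : (W.map (Int.castRingHom ℤ_[2])).formalGroupLaw = ltF hA hP) {ϖ : ℤ_[2]} (hp : ((2 : ℕ) : ℤ_[2]) = ϖ * πZ) (hϖ : IsUnit ϖ)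
    (E : IntermediateField (v.adicCompletion K) (AlgebraicClosure (v.adicCompletion K)))
    [FiniteDimensional (v.adicCompletion K) E] [Normal (v.adicCompletion K) E] [IsGalois (v.adicCompletion K) E]
    (hE : E ≤ maxUnramified (v.adicCompletion K)) {σ₀ : absoluteGaloisGroup (v.adicCompletion K)} (hσ₀ : IsAbsArithFrob σ₀)
    [hEll : ∀ m : ℕ, (curveOver (E ⊔ ltField π m : IntermediateField (v.adicCompletion K) (AlgebraicClosure (v.adicCompletion K)))
      ((W.map (Int.castRingHom ℤ_[2])).map ((LTCoeff.of (v.adicCompletion K)).toRingHom.comp e.symm.toRingHom))).IsElliptic]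
    -- the units `β_i ∈ 𝒰_E` whose components READ the theta values `Θ(1; 𝔪v^{m+1}, 𝔞_i)` (`β_i = ofGlobalUnits (ellipticUnitsGlobal …)`)
    (ι : K →+* ℂ) (h𝔪1 : 𝔪 ≠ ⊤)
    {J : Type*} (β : J → RelNormCoherentUnits hπ E) (𝔞 : J → Ideal (𝓞 K)) (xf : J → ∀ m : ℕ, rayClassField K (𝔪 * v.asIdeal ^ (m + 1)))
    (hxf : ∀ i m, IsThetaValueOne ι (𝔪 * v.asIdeal ^ (m + 1)) (𝔞 i)
      (algClosureEmb ι ((xf i m : rayClassField K (𝔪 * v.asIdeal ^ (m + 1))) : AlgebraicClosure K)))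
    (hβv : ∀ (i : J) (m : ℕ), (((((β i).val m : unitBall (E ⊔ ltField π m : IntermediateField (v.adicCompletion K) (AlgebraicClosure (v.adicCompletion K)))) :
        (E ⊔ ltField π m : IntermediateField (v.adicCompletion K) (AlgebraicClosure (v.adicCompletion K)))) : AlgebraicClosure (v.adicCompletion K))) =
      (absClosureEmbedding K (v.adicCompletion K)).toRingHom ((xf i m : rayClassField K (𝔪 * v.asIdeal ^ (m + 1))) : AlgebraicClosure K))
    -- the split prime: `v = (π₀)`, `2 = π₀π₁`, `π₀ + π₁ = 1`, `π₀` prime, `π₀ ∤ π₁`, `2ᵏ ∉ 𝔪`; `β_K π₀ ≡ 1 (mod 𝔪)`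
    {π₀ π₁ βK : 𝓞 K} (hv0 : v.asIdeal = Ideal.span {π₀}) (h2K : (2 : 𝓞 K) = π₀ * π₁) (htr : π₀ + π₁ = 1) (hprime : Prime π₀)
    (hπ₁ : ¬ π₀ ∣ π₁) (hprime₁ : Prime π₁) (h𝔪π₁ : 𝔪 ≤ Ideal.span {π₁ ^ 3}) (hβK : βK * π₀ - 1 ∈ 𝔪)
    -- the model lattice `L = Ω·ι(𝔪)` of `W ⊗ ℂ`; per unit `L′_i = 𝔞_i⁻¹L` with representatives `S_i`
    (L : PeriodPair) (La : J → PeriodPair) (S : J → Finset ℂ) {Ω : ℂ} (hS : ∀ i, L.IsLatticeReps (La i) (S i))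
    (hLa : ∀ i, (La i).lattice = idealInvLattice ι (𝔞 i) L.lattice)
    (hL : ∀ z : ℂ, z ∈ L.lattice ↔ ∃ a ∈ 𝔪, z = Ω * ι (a : K)) (hΩ : Ω ≠ 0)
    (h₂ : L.g₂ = (W.baseChange ℂ).c₄ / 12) (h₃ : L.g₃ = (W.baseChange ℂ).c₆ / 216)
    -- a `𝔭̄`-division point `ub` of `ℂ/L` (`ι(π₁)ub ∈ L`, `ub ∉ L`)
    {ub : ℂ} (hub1 : ι (π₁ : K) * ub ∈ L.lattice) (hub0 : ub ∉ L.lattice)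
    -- the theta datum over `R`, read `𝔓`-adically by `ψ` and algebraically by `j`
    {R : Type*} [CommRing R] (ψ : R →+* unitBall E) (j : R →+* AlgebraicClosure K)
    (hψj : ∀ r : R, ((((ψ r : unitBall E) : E) : AlgebraicClosure (v.adicCompletion K))) = (absClosureEmbedding K (v.adicCompletion K)).toRingHom (j r))
    (x₀ y₀ x₁ y₁ αR : R) (Kc : J → R) (x : J → ℂ → R) (uc : J → ℂ → Rˣ) (hu : ∀ i, ∀ c ∈ (S i).erase 0, (uc i c : R) = x₀ - x i c)
    (hKj : ∀ i, algClosureEmb ι (j (Kc i)) = L.deltaRatio (La i) * (L.g₂ ^ 3 - 27 * L.g₃ ^ 2) ^ ((S i).card - 1))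
    (hxj : ∀ i, ∀ c ∈ (S i).erase 0, algClosureEmb ι (j (x i c)) = ℘[L] c - (W.baseChange ℂ).b₂ / 12)
    (hx₀ : algClosureEmb ι (j x₀) = ℘[L] Ω - (W.baseChange ℂ).b₂ / 12)
    (hy₀ : algClosureEmb ι (j y₀) = (℘'[L] Ω - (W.baseChange ℂ).a₁ * (℘[L] Ω - (W.baseChange ℂ).b₂ / 12) - (W.baseChange ℂ).a₃) / 2)
    (hx₁ : algClosureEmb ι (j x₁) = ℘[L] (ι (π₀ : K) * Ω) - (W.baseChange ℂ).b₂ / 12)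
    (hy₁ : algClosureEmb ι (j y₁) = (℘'[L] (ι (π₀ : K) * Ω) - (W.baseChange ℂ).a₁ * (℘[L] (ι (π₀ : K) * Ω) - (W.baseChange ℂ).b₂ / 12) -
      (W.baseChange ℂ).a₃) / 2)
    (hαj : algClosureEmb ι (j αR) = ι (π₀ : K))
    (τ : R →+* R) (hτ : ((frobUnitBall E σ₀).symm : unitBall E →+* unitBall E).comp ψ = ψ.comp τ) (hKτ : ∀ i, τ (Kc i) = Kc i)
    (eι : J → ℂ → ℂ) (heT : ∀ i, ∀ c ∈ (S i).erase 0, eι i c ∈ (S i).erase 0) (hinj : ∀ i, Set.InjOn (eι i) ((S i).erase 0 : Finset ℂ))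
    (hsurj : ∀ i, Set.SurjOn (eι i) ((S i).erase 0 : Finset ℂ) ((S i).erase 0 : Finset ℂ))
    (hxτ : ∀ i, ∀ c ∈ (S i).erase 0, τ (x i c) = x i (eι i c))
    (hτx₀ : ∀ m : ℕ, algClosureEmb ι (j (τ^[m + 1] x₀)) = ℘[L] (ι ((βK ^ (m + 1) : 𝓞 K) : K) * Ω) - (W.baseChange ℂ).b₂ / 12)
    (hτy₀ : ∀ m : ℕ, algClosureEmb ι (j (τ^[m + 1] y₀)) = (℘'[L] (ι ((βK ^ (m + 1) : 𝓞 K) : K) * Ω) -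
      (W.baseChange ℂ).a₁ * (℘[L] (ι ((βK ^ (m + 1) : 𝓞 K) : K) * Ω) - (W.baseChange ℂ).b₂ / 12) - (W.baseChange ℂ).a₃) / 2)
    -- the formal CM action over `R`, the transformation pair and its re-centred `R`-lifts, the series identities over `R`
    {T : PowerSeries R} (hT0 : PowerSeries.constantCoeff T = 0)
    (hTP : T.map ψ = (P.map ((LTCoeff.of (v.adicCompletion K)).toRingHom.comp e.symm.toRingHom)).map
      (algebraMap (LTCoeff (v.adicCompletion K)) (unitBall E)))
    {PC QC : Polynomial ℂ}
    (hT : ∀ z : ℂ, z ∉ L.lattice → ι (π₀ : K) * z ∉ L.lattice → PC.eval (℘[L] z) = ℘[L] (ι (π₀ : K) * z) * QC.eval (℘[L] z))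
    (hQC : ∀ z : ℂ, z ∉ L.lattice → ι (π₀ : K) * z ∉ L.lattice → QC.eval (℘[L] z) ≠ 0)
    {Pr Qr : Polynomial R} {s : ℂ} (hs : s ≠ 0)
    (hQr : Qr.map ((algClosureEmb ι).comp j) = Polynomial.C s * QC.comp (Polynomial.X + Polynomial.C ((W.baseChange ℂ).b₂ / 12)))
    (hPr : Pr.map ((algClosureEmb ι).comp j) = Polynomial.C s * (PC.comp (Polynomial.X + Polynomial.C ((W.baseChange ℂ).b₂ / 12)) -
      Polynomial.C ((W.baseChange ℂ).b₂ / 12) * QC.comp (Polynomial.X + Polynomial.C ((W.baseChange ℂ).b₂ / 12))))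
    (hidX : (((W.map (Int.castRingHom R)).translateX x₁ y₁).subst T + C (0 : R)) *
        Polynomial.aeval ((W.map (Int.castRingHom R)).translateX x₀ y₀ + C (0 : R)) Qr =
      Polynomial.aeval ((W.map (Int.castRingHom R)).translateX x₀ y₀ + C (0 : R)) Pr)
    (hidY : C αR * (2 * PowerSeries.subst T ((W.map (Int.castRingHom R)).translateY x₁ y₁) +
            C (W.map (Int.castRingHom R)).a₁ * PowerSeries.subst T ((W.map (Int.castRingHom R)).translateX x₁ y₁) +
            C (W.map (Int.castRingHom R)).a₃) *
          Polynomial.aeval ((W.map (Int.castRingHom R)).translateX x₀ y₀ + C (0 : R)) Qr +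
        (PowerSeries.subst T ((W.map (Int.castRingHom R)).translateX x₁ y₁) + C (0 : R)) *
          Polynomial.aeval ((W.map (Int.castRingHom R)).translateX x₀ y₀ + C (0 : R)) (Polynomial.derivative Qr) *
          (2 * (W.map (Int.castRingHom R)).translateY x₀ y₀ +
            C (W.map (Int.castRingHom R)).a₁ * (W.map (Int.castRingHom R)).translateX x₀ y₀ + C (W.map (Int.castRingHom R)).a₃) =
      Polynomial.aeval ((W.map (Int.castRingHom R)).translateX x₀ y₀ + C (0 : R)) (Polynomial.derivative Pr) *
        (2 * (W.map (Int.castRingHom R)).translateY x₀ y₀ +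
          C (W.map (Int.castRingHom R)).a₁ * (W.map (Int.castRingHom R)).translateX x₀ y₀ + C (W.map (Int.castRingHom R)).a₃))
    -- clause (vi) of the fifth print (II.1.5 (15)) with its conductor ideal `𝔣ψ`, and the READING MODULUS `𝔑 ≤ 𝔣ψ·𝔪·(π₁)` of `E`
    {𝔣ψ : Ideal (𝓞 K)}
    (h6 : ∀ 𝔠 : Ideal (𝓞 K), 𝔠 ≠ ⊥ → ∀ z : ℂ, z ∈ idealInvLattice ι 𝔠 L.lattice → z ∉ L.lattice →
      ∃ x y : rayClassField K (𝔣ψ * 𝔠), algClosureEmb ι x = ℘[L] z ∧ algClosureEmb ι y = ℘'[L] z)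
    {𝔑 : Ideal (𝓞 K)} (h𝔑 : 𝔑 ≠ ⊥) (hv𝔑 : ¬ 𝔑 ≤ v.asIdeal) (h𝔑ψ : 𝔑 ≤ 𝔣ψ * (𝔪 * Ideal.span {π₁}))
    {α : 𝓞 K} (hα0 : α ≠ 0) (hα𝔑 : α - 1 ∈ 𝔑) (hαw : ∀ w : HeightOneSpectrum (𝓞 K), w ≠ v → α ∉ w.asIdeal)
    {f : ℕ} (hαπ : ((α : K) : v.adicCompletion K) = (π : v.adicCompletion K) ^ f)
    (hdegE : ∀ w : WeilGroup (v.adicCompletion K),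
      WeilGroup.toAbsGalois (v.adicCompletion K) w ∈ E.fixingSubgroup → (f : ℤ) ∣ WeilGroup.deg w) :
    ∃ (xu yu : ℕ → AlgebraicClosure K)
      (XU YU : ∀ m : ℕ, ↥(E ⊔ ltField π m : IntermediateField (v.adicCompletion K) (AlgebraicClosure (v.adicCompletion K))))
      (a : 𝒪[(v.adicCompletion K)]ˣ),
      (∀ m : ℕ, algClosureEmb ι (xu m) =
        ℘[L] (ι ((βK ^ (m + 1) : 𝓞 K) : K) * Ω - Ω / ι ((π₀ ^ (m + 1) : 𝓞 K) : K)) - (W.baseChange ℂ).b₂ / 12) ∧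
      (∀ m : ℕ, algClosureEmb ι (yu m) = (℘'[L] (ι ((βK ^ (m + 1) : 𝓞 K) : K) * Ω - Ω / ι ((π₀ ^ (m + 1) : 𝓞 K) : K)) -
        (W.baseChange ℂ).a₁ * (℘[L] (ι ((βK ^ (m + 1) : 𝓞 K) : K) * Ω - Ω / ι ((π₀ ^ (m + 1) : 𝓞 K) : K)) - (W.baseChange ℂ).b₂ / 12) -
        (W.baseChange ℂ).a₃) / 2) ∧
      (∀ m, ((XU m : ↥(E ⊔ ltField π m : IntermediateField (v.adicCompletion K) (AlgebraicClosure (v.adicCompletion K)))) :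
          AlgebraicClosure (v.adicCompletion K)) = (absClosureEmbedding K (v.adicCompletion K)).toRingHom (xu m)) ∧
      (∀ m, ((YU m : ↥(E ⊔ ltField π m : IntermediateField (v.adicCompletion K) (AlgebraicClosure (v.adicCompletion K)))) :
          AlgebraicClosure (v.adicCompletion K)) = (absClosureEmbedding K (v.adicCompletion K)).toRingHom (yu m)) ∧
      (∀ (m : ℕ) (h : (curveOver (E ⊔ ltField π m : IntermediateField (v.adicCompletion K) (AlgebraicClosure (v.adicCompletion K)))
          ((W.map (Int.castRingHom ℤ_[2])).map ((LTCoeff.of (v.adicCompletion K)).toRingHom.comp e.symm.toRingHom))).toAffine.Nonsingular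
          (XU m) (YU m)),
        ptOfZ (E ⊔ ltField π m : IntermediateField (v.adicCompletion K) (AlgebraicClosure (v.adicCompletion K)))
            ((W.map (Int.castRingHom ℤ_[2])).map ((LTCoeff.of (v.adicCompletion K)).toRingHom.comp e.symm.toRingHom))
            (evalPt₁ (maxNilIdeal (v.adicCompletion K) (E ⊔ ltField π m : IntermediateField (v.adicCompletion K) (AlgebraicClosure (v.adicCompletion K))))
              (hom (isLTRing_LTCoeff hπ) (isLTSeries_map_LTCoeff_of_degree_one e hq heπ hP) (isLTSeries_LTCoeff π) 1)
              (constantCoeff_hom _ _ _ 1)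
              (evalPt₁ (maxNilIdeal (v.adicCompletion K) (E ⊔ ltField π m : IntermediateField (v.adicCompletion K) (AlgebraicClosure (v.adicCompletion K))))
                (hom (isLTRing_LTCoeff hπ) (isLTSeries_LTCoeff π) (isLTSeries_LTCoeff π) (LTCoeff.of (v.adicCompletion K) (a : 𝒪[(v.adicCompletion K)])))
                (constantCoeff_hom _ _ _ _)
                (inclPt (le_sup_right : ltField π m ≤ E ⊔ ltField π m) (cohPt hπ m)))) =
          (.some (XU m) (YU m) h : (curveOver (E ⊔ ltField π m : IntermediateField (v.adicCompletion K) (AlgebraicClosure (v.adicCompletion K)))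
            ((W.map (Int.castRingHom ℤ_[2])).map ((LTCoeff.of (v.adicCompletion K)).toRingHom.comp e.symm.toRingHom))).toAffine.Point)) ∧
      ∀ i : J, relColemanSeries hπ E hq hE hσ₀ (β i) =
        PowerSeries.subst ((hom (isLTRing_LTCoeff hπ) (isLTSeries_LTCoeff _) (isLTSeries_LTCoeff _)
            (LTCoeff.of (v.adicCompletion K) (a : 𝒪[(v.adicCompletion K)]))).map
            (algebraMap (LTCoeff (v.adicCompletion K)) (unitBall E)))
          (PowerSeries.subst ((hom (isLTRing_LTCoeff hπ) (isLTSeries_map_LTCoeff_of_degree_one e hq heπ hP) (isLTSeries_LTCoeff _) 1).map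
            (algebraMap (LTCoeff (v.adicCompletion K)) (unitBall E)))
            (PowerSeries.map ψ (C (Kc i) * ∏ c ∈ (S i).erase 0,
              PowerSeries.invOfUnit (((W.map (Int.castRingHom R)).translateX x₀ y₀).subst (W.map (Int.castRingHom R)).formalNeg - C (x i c))
                (uc i c) ^ 6)))  := by
  -- `π₀ᵏ ∉ 𝔪` (else `2ᵏ = π₀ᵏπ₁ᵏ ∈ 𝔪`)
  have hπ₀𝔪 : ∀ k : ℕ, (π₀ ^ k : 𝓞 K) ∉ 𝔪 := pow_notMem_of_le_span_pow hprime₁ htr (n := 3) (by norm_num) h𝔪π₁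
  -- the levelwise readings of `ξ(u_{m+1})`, `ξ(Ω/π₀^{m+1})`, `ξ(Ω + u_{m+2})`, `ξ(π₀(Ω + u_{m+2}))` (reading modulus `𝔑 ≤ 𝔣ψ·𝔪`)
  obtain ⟨-, -, xq, yq, xw, yw, xz, yz, -, -, XQ, YQ, XW, YW, XZ, YZ, -, -, hxq, hyq, hxw, hyw, hxz, hyz, -, -, hXQ, hYQ, hXW, hYW,
      hXZ, hYZ⟩ :=
    exists_divisionPt_readings ι L W h6 hL hΩ hv0 h2K hprime hπ₁ hπ₀𝔪 hβK h𝔑 hv𝔑 (h𝔑ψ.trans (Ideal.mul_mono_right Ideal.mul_le_right))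
      hπ hα0 hα𝔑 hαw hαπ E hdegE
  -- the four (N1) reading families, per level (reading modulus `𝔑 ≤ 𝔣ψ·𝔪·(π₁)`)
  choose xY yY XY YY xS yS XS YS xW' yW' XW' YW' xZ' yZ' XZ' YZ' hxY hyY hXY hYY hxS hyS hXS hYS hxW' hyW' hXW' hYW' hxZ' hyZ' hXZ' hYZ'
    using fun m : ℕ => exists_divisionPt_readings_at_level_of_le_span_sq ι L W h6 hL hΩ hv0 htr hβK h2K hprime hπ₁ hprime₁
      (le_span_sq_of_le_span_cube h𝔪π₁) hub1 hub0
      (αc := ι (π₀ : K)) rfl h𝔑 hv𝔑 h𝔑ψ hπ hα0 hα𝔑 hαw hαπ E hdegE m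
  -- the generic bridge with the Tate unit exposed
  obtain ⟨a, ha, hβ⟩ := exists_tateUnit_forall_relColemanSeries_eq_subst_subst_of_readings_of_le_span_cube e hq hπ heπ hA hP W hW hV hp hϖ E
    hE hσ₀ ι (absClosureEmbedding K (v.adicCompletion K)).toRingHom h𝔪1 β 𝔞 xf hxf hβv hv0 h2K htr hprime hπ₁ hprime₁ h𝔪π₁ hβK L La S hS
    hLa hL hΩ h₂ h₃
    hub1 hub0 ψ j hψj x₀ y₀ x₁ y₁ αR Kc x uc hu hKj hxj hx₀ hy₀ hx₁ hy₁ hαj τ hτ hKτ eι heT hinj hsurj hxτ hτx₀ hτy₀ hT0 hTP hT hQC hs hQr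
    hPr hidX hidY xq yq xw yw xz yz hxq hyq hxw hyw hxz hyz XQ YQ XW YW XZ YZ hXQ hYQ hXW hYW hXZ hYZ xY yY XY YY hxY hyY hXY hYY xS yS XS
    YS hxS hyS hXS hYS xW' yW' XW' YW' hxW' hyW' hXW' hYW' xZ' yZ' XZ' YZ' hxZ' hyZ' hXZ' hYZ'
  exact ⟨fun m => xY m m, fun m => yY m m, fun m => XY m m, fun m => YY m m, a, fun m => hxY m m le_rfl, fun m => hyY m m le_rfl,
    fun m => hXY m m le_rfl, fun m => hYY m m le_rfl, ha, hβ⟩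

end Summit.BirchSwinnertonDyer.BirchSwinnertonDyer.Theorems.PrintCf2.KatzMeasureJZeroSeam

end
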